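import Summits.QuantumAdvantage.QuantumAdvantage.Theorems.CubicForrelationNearExactIsExactFourteenSecondStructure
import Summits.QuantumAdvantage.QuantumAdvantage.Theorems.CubicForrelationNearExactIsExactFourteenSecondBent

/-!
# Crux `CubicForrelation.NearExactIsExact` (stmt-QuantumAdvantage-14043) — n = 14 at the SECOND boundary `15/16`:
  the SHARPENED structure of a hypothetical pair with `15/16 ≤ Φ < 1` (level `≥ 7` fully excluded)

Certificate seat `b2b-cforr-cert` (gen 9).  HONEST FRAMING: a theorem about cubic Boolean pairs on 14 bits — the certified search space for
the open question `θ₁₄ < 15/16` after the bent branch was also killed (`fo_bent_false`, `fo_levelSeven_exact`) — NOT a proof of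
`θ₁₄ < 15/16`, NOT summit progress.

`fo_second_structure_sharp`: if cubic `f, g : 𝔽₂¹⁴ → 𝔽₂` have `15/16 ≤ Φ(f,g) < 1` then, with `W_g = 32u_g`, `W_f = 32u_f`:
* `g` is at level 6 (`W_g = 64u'`) with `2¹² ≤ #{u' odd} < 2¹³`, or the same for `f`; or
* both are of type O (`u` odd everywhere) and on EACH side the first digit `d₁ = [⌊u/2⌋ odd]` has a radical of size `< 2¹²` (rank `≥ 4`)
  or `[⌊u/2⌋ odd] ≠ [⌊u/4⌋ odd]` everywhere (case A).
In particular (`fo_high_levels_exact`) a pair in which NEITHER spectrum is of type O nor at level 6 is exact as soon as `Φ ≥ 15/16`.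
Paper analysis beyond this (seat notes, not formalised): rank `d₁ ≥ 8` is impossible by a double count over rank-6 sections
(minimum weight `8` of the coset `ω⁽²⁾ + RM(3,6)`), rank `6` forces `{d₁ = d₂}` to be a union of radical cosets and dies against the
partner's parity; the genuinely open type-O residue is rank `4` and case A.

References: as in the imported files.  Everything below is proved from Mathlib and the tree; axioms are the standard three.
-/

set_option linter.dupNamespace false -- D-0017: single-problem summit ⇒ `QuantumAdvantage.QuantumAdvantage` by design

noncomputable section

namespace Summit.QuantumAdvantage.QuantumAdvantage.Theorems.CubicForrelation.NearExactIsExact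

open Finset
open Literature.Computability.QuantumComplexity
open Literature.Computability.QuantumComplexity.BuzetChailloux (bxor zeroVec)
open Literature.Computability.QuantumComplexity.DerivativeWalsh (W)
open Summit.QuantumAdvantage.QuantumAdvantage.Theorems.SignedCubicForrelationNotPrBPP.Negative.HalfQuad (forrelation_comm)

/-- **Sharpened structure at the second boundary on 14 bits.**  If cubic `f, g : 𝔽₂¹⁴ → 𝔽₂` satisfy `15/16 ≤ Φ(f,g)` and `Φ(f,g) ≠ 1`,
then `g` is at level 6 with `2¹² ≤ #{W_g/64 odd} < 2¹³`, or `f` is, or both spectra are of type O and on each side the radical of the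
first digit has fewer than `2¹²` elements or case A holds.  (The bent alternatives of `fo_second_structure` are removed by
`fo_bent_false`.)  NOT a proof of `θ₁₄ < 15/16`; NOT summit progress. [this work] -/
theorem fo_second_structure_sharp (f g : (Fin (7 + 7) → Bool) → Bool) (hf : IsDegLeFun 3 f) (hg : IsDegLeFun 3 g)
    (hΦ : (15 / 16 : ℝ) ≤ forrelation f g) (hne : forrelation f g ≠ 1) :
    (∃ u' : (Fin (7 + 7) → Bool) → ℤ, (∀ x, W (fun y => signOf (g y)) x = (2 : ℝ) ^ 6 * (u' x : ℝ)) ∧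
      4096 ≤ #(univ.filter fun x : Fin (7 + 7) → Bool => Odd (u' x)) ∧
      #(univ.filter fun x : Fin (7 + 7) → Bool => Odd (u' x)) < 8192) ∨
    (∃ v' : (Fin (7 + 7) → Bool) → ℤ, (∀ y, W (fun x => signOf (f x)) y = (2 : ℝ) ^ 6 * (v' y : ℝ)) ∧
      4096 ≤ #(univ.filter fun y : Fin (7 + 7) → Bool => Odd (v' y)) ∧
      #(univ.filter fun y : Fin (7 + 7) → Bool => Odd (v' y)) < 8192) ∨
    (∃ u v : (Fin (7 + 7) → Bool) → ℤ, (∀ x, W (fun y => signOf (g y)) x = (2 : ℝ) ^ 5 * (u x : ℝ)) ∧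
      (∀ y, W (fun x => signOf (f x)) y = (2 : ℝ) ^ 5 * (v y : ℝ)) ∧ (∀ x, Odd (u x)) ∧ (∀ y, Odd (v y)) ∧
      (#(univ.filter fun a : Fin (7 + 7) → Bool => ∀ b, (decide (Odd (u zeroVec / 2)) ^^ decide (Odd (u a / 2)) ^^
          decide (Odd (u b / 2)) ^^ decide (Odd (u (bxor a b) / 2))) = false) < 2 ^ 12 ∨
        ∀ x, ¬ (Odd (u x / 2) ↔ Odd (u x / 2 / 2))) ∧
      (#(univ.filter fun a : Fin (7 + 7) → Bool => ∀ b, (decide (Odd (v zeroVec / 2)) ^^ decide (Odd (v a / 2)) ^^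
          decide (Odd (v b / 2)) ^^ decide (Odd (v (bxor a b) / 2))) = false) < 2 ^ 12 ∨
        ∀ y, ¬ (Odd (v y / 2) ↔ Odd (v y / 2 / 2)))) := by
  rcases fo_second_structure f g hf hg hΦ hne with ⟨hb, h15⟩ | ⟨hb, h15⟩ | h | h | h
  · exact (fo_bent_false f g hf hg hb h15).elim
  · have h15' : forrelation g f = 15 / 16 := by rw [forrelation_comm]; exact h15
    exact (fo_bent_false g f hg hf hb h15').elim
  · exact Or.inl h
  · exact Or.inr (Or.inl h)
  · exact Or.inr (Or.inr h)

/-- **Both spectra even above level 6 ⇒ exact.**  For cubic `f, g` on 14 bits with `W_g ∈ 128ℤ`, `W_f ∈ 128ℤ`… in fact ONE side suffices: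
if `W_g ∈ 128ℤ` and `Φ(f,g) ≥ 15/16` then `Φ(f,g) = 1` (`fo_levelSeven_exact`); recorded here at the literal type `Fin 14`.  NOT summit
progress. [this work] -/
theorem fo_high_levels_exact (f g : (Fin 14 → Bool) → Bool) (hf : IsDegLeFun 3 f) (hg : IsDegLeFun 3 g)
    (w : (Fin 14 → Bool) → ℤ) (hw : ∀ x, W (fun y => signOf (g y)) x = (2 : ℝ) ^ 7 * (w x : ℝ))
    (hΦ : (15 / 16 : ℝ) ≤ forrelation f g) : forrelation f g = 1 :=
  fo_levelSeven_exact f g hf hg w hw hΦ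

/-- **The sharpened structure at the literal type `Fin 14`.**  NOT a proof of `θ₁₄ < 15/16`; NOT summit progress. [this work] -/
theorem second_boundary_structure_fourteen_sharp (f g : (Fin 14 → Bool) → Bool) (hf : IsDegLeFun 3 f) (hg : IsDegLeFun 3 g)
    (hΦ : (15 / 16 : ℝ) ≤ forrelation f g) (hne : forrelation f g ≠ 1) :
    (∃ u' : (Fin (7 + 7) → Bool) → ℤ, (∀ x, W (fun y => signOf (g y)) x = (2 : ℝ) ^ 6 * (u' x : ℝ)) ∧
      4096 ≤ #(univ.filter fun x : Fin (7 + 7) → Bool => Odd (u' x)) ∧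
      #(univ.filter fun x : Fin (7 + 7) → Bool => Odd (u' x)) < 8192) ∨
    (∃ v' : (Fin (7 + 7) → Bool) → ℤ, (∀ y, W (fun x => signOf (f x)) y = (2 : ℝ) ^ 6 * (v' y : ℝ)) ∧
      4096 ≤ #(univ.filter fun y : Fin (7 + 7) → Bool => Odd (v' y)) ∧
      #(univ.filter fun y : Fin (7 + 7) → Bool => Odd (v' y)) < 8192) ∨
    (∃ u v : (Fin (7 + 7) → Bool) → ℤ, (∀ x, W (fun y => signOf (g y)) x = (2 : ℝ) ^ 5 * (u x : ℝ)) ∧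
      (∀ y, W (fun x => signOf (f x)) y = (2 : ℝ) ^ 5 * (v y : ℝ)) ∧ (∀ x, Odd (u x)) ∧ (∀ y, Odd (v y)) ∧
      (#(univ.filter fun a : Fin (7 + 7) → Bool => ∀ b, (decide (Odd (u zeroVec / 2)) ^^ decide (Odd (u a / 2)) ^^
          decide (Odd (u b / 2)) ^^ decide (Odd (u (bxor a b) / 2))) = false) < 2 ^ 12 ∨
        ∀ x, ¬ (Odd (u x / 2) ↔ Odd (u x / 2 / 2))) ∧
      (#(univ.filter fun a : Fin (7 + 7) → Bool => ∀ b, (decide (Odd (v zeroVec / 2)) ^^ decide (Odd (v a / 2)) ^^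
          decide (Odd (v b / 2)) ^^ decide (Odd (v (bxor a b) / 2))) = false) < 2 ^ 12 ∨
        ∀ y, ¬ (Odd (v y / 2) ↔ Odd (v y / 2 / 2)))) :=
  fo_second_structure_sharp f g hf hg hΦ hne

end Summit.QuantumAdvantage.QuantumAdvantage.Theorems.CubicForrelation.NearExactIsExact

end
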